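import Summits.RiemannHypothesis.RiemannHypothesis.Theorems.Splittings.ScrewNullCombination
import Summits.RiemannHypothesis.RiemannHypothesis.Theorems.Splittings.ScrewBridgeRigidity

/-!
# Splittings — SCREW NULL COMBINATIONS, corollaries: residual R2 DISCHARGED — `FOZ ⟹ the screw Gram matrices are
# eventually nonsingular` and `InertiaOfFoz : FOZ ⟹ ETAIL`; T2 (`ETAIL ⟺ FOZ`) open at R3 (`IndexTransfer`) only

Cell rh-split (brief sha16 f79c5f09d8bcb036), seat rh-split-typer-2 g3 (prover), on `cards/SPLIT-screw-bridge.md` §8/§9 (target T2,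
residuals R1 `FozIndexBound` = tree `IntegerScrew.FozIndexBound.fozIndexBound`, R2 `FozNonsingular`, R3 `IndexTransfer`).  With
FOZ = `Theses.RuelleBand.CofiniteCriticalLine`, ETAIL = `∃ M₀, ∀ M ≥ M₀, 0 < screwPivot M`, negative index
`n₋(n) = #{i | λ_i(screwMatrix n) < 0}` written out:

* `nnc_of_cofiniteCriticalLine` — FOZ ⟹ NNC (`ScrewNullCombination.nnc_of_finite_offline`, whose hypothesis is the body of
  `CofiniteCriticalLine` verbatim);
* `fozNonsingular_of_foz` — **R2**: FOZ ⟹ `∃ N, ∀ n ≥ N, screwDet n ≠ 0`, by rh-split-screw-bridge g4's rigidity theorem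
  `ScrewBridgeRigidity.fozNonsingular_of_nnc` (a frozen negative index makes every degeneracy a rigid null combination);
* `etail_of_foz` — **`InertiaOfFoz`: FOZ ⟹ ETAIL** (R1 + R2, `ScrewBridgeFozConsequences.etail_of_foz_of_nonsingular`): given
  finitely many off-line zeros, the screw pivots are eventually POSITIVE — unconditionally as an implication, RH-free;
* `etail_iff_foz_of_indexTransfer` — T2 `ETAIL ⟺ FOZ` modulo R3 alone (`ScrewBridgeFozConsequences.etail_iff_foz_of`);
* `foz_not_singular_io` — the FOZ-dichotomy of `ScrewBridgeFozConsequences.foz_dichotomy` always takes its first branch.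

Matrix reading (for the lead/referee): the screw ∃-tail ETAIL is now KERNEL-implied by FOZ; the bridge «FOZ ⟹ ETAIL» of the
screw × bridge card is a THEOREM, so `ETAIL` sits between FOZ and «bounded negative index» (`etail_iff_boundedIndex_and_nonsingular`),
and the only open arrow of T2 is R3 (`IndexTransfer` / Lemma U′).  Class of the (screw, bridge) cell UNCHANGED (barrier-note): the
∃-tail door remains the FOZ costume, now by theorem in one direction.

HONEST LABEL: RH-free theorems GIVEN finitely many off-line zeros (FOZ is RH-implied and open); part of a CONDITIONAL bridge
(cell rh-split: «SPLITTING SEARCH over kernel-typed RH-EQUIVALENCES; a splitting A ∧ B ⟹ RH is CONDITIONAL bookkeeping unless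
A and B are both proved») and nothing here bears on the truth of RH.
-/

set_option linter.dupNamespace false

noncomputable section

namespace Summit.RiemannHypothesis.RiemannHypothesis.Theorems.Splittings.ScrewNullComb

open Finset Matrix
open Literature.NumberTheory.LFunctions
open Summit.RiemannHypothesis.RiemannHypothesis.Theses.RuelleBand
open Summit.RiemannHypothesis.RiemannHypothesis.Theorems.IntegerScrew

/-- **FOZ ⟹ NNC**: given finitely many off-line zeros, no non-zero finite real combination of screw-kernel sections vanishes
at every node. [new] -/
theorem nnc_of_cofiniteCriticalLine (hfoz : CofiniteCriticalLine) :
    ∀ n : ℕ, ∀ z : Fin n → ℝ,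
      (∀ i : ℕ, ∑ j : Fin n, zetaScrewKernel (Real.log ((i + 2 : ℕ) : ℝ))
        (Real.log (((j : ℕ) + 2 : ℕ) : ℝ)) * z j = 0) → z = 0 :=
  nnc_of_finite_offline hfoz

/-- **Residual R2 discharged: FOZ ⟹ the screw Gram matrices are eventually nonsingular** (NNC + the rigidity of degeneracy
under a frozen negative index, `ScrewBridgeRigidity.fozNonsingular_of_nnc`). [new] -/
theorem fozNonsingular_of_foz (hfoz : CofiniteCriticalLine) : ∃ N : ℕ, ∀ n : ℕ, N ≤ n → screwDet n ≠ 0 :=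
  ScrewBridgeRigidity.fozNonsingular_of_nnc (nnc_of_finite_offline hfoz) hfoz

/-- **`InertiaOfFoz`: FOZ ⟹ ETAIL.** Given finitely many off-line zeros, the screw pivots `d_M` are eventually positive
(R1 `fozIndexBound` + R2 `fozNonsingular_of_foz`, via `ScrewBridgeFozConsequences.etail_of_foz_of_nonsingular`). [new] -/
theorem etail_of_foz (hfoz : CofiniteCriticalLine) : ∃ M₀ : ℕ, ∀ M : ℕ, M₀ ≤ M → 0 < screwPivot M :=
  ScrewBridgeFozConsequences.etail_of_foz_of_nonsingular hfoz (fozNonsingular_of_foz hfoz)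

/-- **T2 modulo R3 alone**: if a bounded negative index of the screw matrices forces FOZ (`IndexTransfer`, the one remaining
residual), then `ETAIL ⟺ FOZ`. [new-combination] -/
theorem etail_iff_foz_of_indexTransfer
    (hT : (∃ K : ℕ, ∀ n : ℕ, (Finset.univ.filter fun i => (screwMatrix_isHermitian n).eigenvalues i < 0).card ≤ K) →
      CofiniteCriticalLine) :
    (∃ M₀ : ℕ, ∀ M : ℕ, M₀ ≤ M → 0 < screwPivot M) ↔ CofiniteCriticalLine :=
  ScrewBridgeFozConsequences.etail_iff_foz_of hT fun hfoz => fozNonsingular_of_foz hfoz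

/-- The FOZ-dichotomy resolved: under FOZ the screw matrices are NOT singular infinitely often. [new-combination] -/
theorem foz_not_singular_io (hfoz : CofiniteCriticalLine) : ¬ ∀ N : ℕ, ∃ n : ℕ, N ≤ n ∧ screwDet n = 0 := by
  obtain ⟨N, hN⟩ := fozNonsingular_of_foz hfoz
  intro h
  obtain ⟨n, hn, hdet⟩ := h N
  exact hN n hn hdet

end Summit.RiemannHypothesis.RiemannHypothesis.Theorems.Splittings.ScrewNullComb

end
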